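import Summits.QuantumFields.YangMills.Theorems.BalabanUVNodesK0Stub1SectFWSlotAtRecord
import Summits.QuantumFields.YangMills.Theorems.BalabanUVNodesK0Stub1MultiplierO1LetterAtRecord
import HarnessLib

/-!
# K0⁷ STUB 1 (`stub_prop8StepCoP13`), sub-target S4b «the (δ∕δA′)V pieces at objects» — THE W-SLOT OF SECT. F's `W` AT THE RECORD,
# **CHART-SOCKET EDITION**: the capstone `K0Stub1SectFWSlotOneLevel.exists_sectF_W_levOf` at every torus `P` (`4 ≤ d`), height `k`, (2.2)-admissible nested family and
# fibre `M_N(ℂ)` with the CHART OF RECORD left as a SOCKET — ANY map `Dfun` analytic on the weighted sup-ball obeying the (55)-family bound `C_D·ρ′²`, ANY ℂ-linear `H`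
# with the two (46) rows, ANY average `Q` — so that dag-n07-w2's single-bar chart (today's record: p612123 = this theorem ∘ part 2) AND a double-bar re-base
# (`chartLogFlat`, ym3-torus RULING g26-№6, UST files in the tree) plug in BY NAME with no further S4b work

Cell `pub-ymgap`, width seat `pub-ymgap-k0-s1-w2` g4 (CLAIM-3; companion of LOCATED-BASEPOINT, evidence #51 on stmt-QuantumFields-20541).  `--kind proof --supports
stmt-QuantumFields-20541 --as helper`; count-neutral.  [15] = [Balaban1985Variational]; [B6] = [Balaban1984PropagatorsII].

WHY.  p612123 (`exists_sectF_W_atRecord_of_numericLetters(_anyQ)`) hard-wires the single-bar chart: its `Dfun`, (55), (49), (48), analyticity and the `ε`-window come from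
dag-n07-w2's `N07ChartDDerivative` ∕ part 2 `contDiffOn_chartD` for `Prop8Chart.chartLog`.  LOCATED-BASEPOINT (this seat, bus 2026-08-28 08:28Z ∕ 08:44Z): with that chart the
displayed letter `θ₀` ((73)ᵀ) is not k-uniformly inhabitable (base-point modes of the single-bar remainder), and one located cure is a re-base of S2's chart on print's double-bar
functional.  Everything S4b proved is in fact CHART-PARAMETRIC — the g2 capstone takes `D, 𝔇, Dᵗ, H, Q, Qᵗ, Hᵗ` as data with hypotheses — except the record plumbing of p612123.
THIS FILE re-does that plumbing against an abstract chart: from `ContDiffOn ℂ ω Dfun` on the open weighted sup-ball (Mathlib: `contDiffOn_succ_iff_fderiv_of_isOpen`) it derives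
`hD`, `hDdiff`, `DifferentiableOn ℂ (fderiv Dfun)`; part 1's transposes by formula give `Qt Ht Dt` with `hQt hHt hDt hDtdiff`; the two (46) rows of `H` and (55) give BOTH halves of
(57)–(58) with `ℓ ≥ 1 + B₀C_Dε`, `ℓ ≥ 1 + B₁C_Dε`; part 5 gives the collar; §0 of p612123 the fibre constant.  No right-inverse property of `H`, no `Qlin`, no window on `ε` is
used: those are facts ABOUT the chart that the consumer holds together with (48)–(49) for the identification of `V`.

WHAT IS PROVED (sorry-free; no definition; axioms standard).
* ★★★ `exists_sectF_W_atRecord_of_chartSocket` — binders: `N`, `P` (`4 ≤ d`), `k`, `Adm22 Dm R′ M` with `1 ≤ R′M`, weights `IsLevWeight P k Dm w`; ℂ-linear `H` with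
  sup row `B₀` and gradient row `B₁`; `ε > 0`, `C_D ≥ 0`, a map `Dfun` with the (55) family on the sup-ball and `ContDiffOn ℂ ω Dfun` there; the fibre letters `τ ρ` (`hρ hτ hτs hτ1`,
  `‖ρℓ‖ ≤ M_ρ‖ℓ‖`); pairings `BE` = (27), `B` = block trace (symmetric); a `B`-symmetric multiplier `MV`; any `Q`.  CONCLUSION: `∃ Qt Ht Dt` with `hQt hHt hDt` and, for all
  `wB′ O₁ q₀ θ₀ h₀ ℓ q` with `0 ≤ O₁ θ₀ h₀`, `1 + B₀C_Dε ≤ ℓ`, `1 + B₁C_Dε ≤ ℓ`, `ℓε ≤ 1∕16` and the five letters `h3132 hQt' h73t h46t hQ` (p612123's shapes verbatim):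
  `∃ e W` with the (63)-certificate for `V = ½B(Dfun A, MV·Dfun A) − B(QA, MV·Dfun A) + V₀(A − H·Dfun A)`, `hWd`, and `hWq` with
  `C₄ = θ₀O₁(C_Dε + q) + q₀O₁C_D + (1 + θ₀εh₀)(d−1)L⁶M_ρ(200 + 2L²)ℓ²`.
* §2 ★★★ `exists_sectF_W_atRecord_of_chartSocket_O1` — the same at every admissible family of the record's four-tori (`T4Family` currency, thresholds `Mh₀`, `R₀ ≥ 1`)
  with the multiplier of record `η^d•M_V` (p598821's kernel formula, any auxiliary weights) and `O₁` DISCHARGED by k0-s1-w4's `h3132_of_adm22_T4` (p616957) on the band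
  `0 ≤ wB′(t) ≤ (L^{j(t)}η)⁻¹`: displayed `q₀ θ₀ h₀ ℓ q` only.
HONEST SCOPE ∕ WHAT THIS IS NOT.  (1) Bookkeeping over kernel-checked theorems; NO estimate.  (2) The socket does not make the numbers exist: for the single-bar chart `θ₀` is
located NOT k-uniform (evidence #51); for the double-bar chart the (157)♭ kernel (UST `…ChartKernelFlatAssembly`) is the expected supplier — neither asserted here.  (3) Whether `V`
with (`Q`, `H`, `MV`, `Dfun`) IS Sect. F's functional at the record is road R0′'s (87)∕(128) junction — NOT asserted.  (4) `stub_prop8StepCoP13` ∕ K0⁷ NOT closed; N07 NOT discharged;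
counts unmoved (28∕28 · 5∕27); one finite 𝕋⁴ programme at fixed ε — R4 closes the conditional finite-𝕋⁴ rung `BalabanLadder.UV` only, never the summit; the YM mass gap (Clay) is NOT
proved by any of this; nothing continuum ∕ ℝ⁴ ∕ OS.  No `sorry`, no `def`, no `instance`, no `notation`.

References: [15] (27) p.282, (45)–(50) p.285, (55)–(58) pp.286–287, (63)–(73) pp.287–289, (87)–(90) p.291, Prop. 4 (97)–(98) pp.292–293, (157)–(158) p.302; [B6] (2.2) p.224, (2.35)
p.228, Cor. 2.8 p.249; [Balaban1985Averaging] (89) p.31, Prop. 5 (157) pp.40–42.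
-/

set_option autoImplicit false

noncomputable section

open scoped BigOperators Matrix.Norms.L2Operator Topology ContDiff
open NormedSpace Metric Set Filter

namespace Summit.QuantumFields.YangMills.Theorems.K0Stub1SectFWSlotAtRecordSocket

open Literature.MathematicalPhysics.QuantumFieldTheory.Balaban1983to89
open Literature.MathematicalPhysics.QuantumFieldTheory.Balaban1983to89.B6SectADomainsV1 (Domains)
open Literature.MathematicalPhysics.QuantumFieldTheory.Balaban1983to89.T4Continuum (T4Family)
open Literature.MathematicalPhysics.QuantumFieldTheory.Balaban1983to89.B6SectAOperatorsV1 (BondIdx aE)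
open Literature.MathematicalPhysics.QuantumFieldTheory.Balaban1983to89.B6SectAVectorModelV1 (EE)
open B4Sect5Torus (TSite)
open B9Eq39Adjoint (bondPair)
open B11Eq26ActionExpansion (V0)
open Summit.QuantumFields.YangMills.Theorems.FlatCubeOpsText (Adm22)
open Summit.QuantumFields.YangMills.Theorems.K0FlatCubeOpsTextP (IsLevWeight)
open Summit.QuantumFields.YangMills.Theorems.K0Stub1SectFWSlotOneLevel (exists_sectF_W_levOf)
open Summit.QuantumFields.YangMills.Theorems.K0Stub1TransposesByDualiser (exists_capstoneTransposes)
open Summit.QuantumFields.YangMills.Theorems.K0Stub1ChartDAnalytic (isOpen_weightedBall)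
open Summit.QuantumFields.YangMills.Theorems.K0Stub1OneStepCollarOfAdm22 (oneStepCollar_of_adm22)
open Summit.QuantumFields.YangMills.Theorems.K0Stub1SectFWSlotAtRecord (fibreSlotConst_le_of_letterBounds)
open Summit.QuantumFields.YangMills.Theorems.K0Stub1MultiplierO1LetterAtRecord (h3132_of_adm22_T4 smul_multiplier_symm)

/-- ★★★ **THE W-SLOT OF SECT. F's `W = (δ∕δA′)V` AT THE RECORD, CHART-SOCKET EDITION** (see the module docstring for the binder list and the conclusion; the chart is the
SOCKET `Dfun` + (55)-family + `ContDiffOn ℂ ω`, the operators `H`, `Q`, `MV` are parameters, the numbers `O₁ q₀ θ₀ h₀ q` are displayed letters).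
[cite: Balaban1985Variational, Prop. 4 (97)-(98) pp.292-293, (157)-(158) p.302, (63) p.287, (87)-(90) p.291, (27) p.282, (45)-(50) p.285, (55)-(58) pp.286-287, (73) p.289; Balaban1984PropagatorsII, (2.2) p.224, Cor. 2.8 p.249] -/
theorem exists_sectF_W_atRecord_of_chartSocket (N : ℕ) [NeZero N] (P : Params) (hd : 4 ≤ P.d) (k : ℕ)
    [Fact ((0 : ℝ) < (P.L : ℝ))] [Fact ((0 : ℝ) < ((P.L : ℝ))⁻¹ ^ k)]
    {R' M : ℕ} (hRM : 1 ≤ R' * M) (Dm : Domains P) (hAdm : Adm22 Dm R' M)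
    {w : ℕ → PBond P 0 → ℝ} (hw : IsLevWeight P k Dm w)
    -- ANY ℂ-linear `H` with BOTH (46) rows (the right inverse of the chart's linearisation in every reading; no inverse property is used here)
    (H : (BondIdx Dm → Matrix (Fin N) (Fin N) ℂ) →ₗ[ℂ] (PBond P 0 → Matrix (Fin N) (Fin N) ℂ))
    {B₀ : ℝ} (hB₀ : 0 ≤ B₀)
    (hHB : ∀ (X : BondIdx Dm → Matrix (Fin N) (Fin N) ℂ) (t : ℝ), 0 ≤ t → (∀ i, ‖X i‖ ≤ t) → ∀ b, w 1 b * ‖H X b‖ ≤ B₀ * t)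
    {B₁ : ℝ} (hB₁ : 0 ≤ B₁)
    (hHgrad : ∀ (X : BondIdx Dm → Matrix (Fin N) (Fin N) ℂ) (t : ℝ), 0 ≤ t → (∀ i, ‖X i‖ ≤ t) →
      ∀ (b : PBond P 0) (ν : Fin P.d), w 2 b * (P.L : ℝ) ^ k * ‖H X ⟨b.src.shift ν, b.dir⟩ - H X b‖ ≤ B₁ * t)
    -- ★ THE CHART SOCKET: ANY map `Dfun` ANALYTIC on the weighted sup-ball of radius `ε` obeying the (55)-family bound with constant `C_D`
    -- (single-bar of record: dag-n07-w2's `exists_chartD_hasFDerivAt` + part 2 `contDiffOn_chartD`, `C_D = 4C₂`; double-bar: the ♭ twins)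
    {ε : ℝ} (hε : 0 < ε) {CD : ℝ} (hCD : 0 ≤ CD)
    (Dfun : (PBond P 0 → Matrix (Fin N) (Fin N) ℂ) → (BondIdx Dm → Matrix (Fin N) (Fin N) ℂ))
    (h55 : ∀ A' : PBond P 0 → Matrix (Fin N) (Fin N) ℂ, (∀ b, w 1 b * ‖A' b‖ < ε) →
      ∀ ρ' : ℝ, 0 ≤ ρ' → (∀ b, w 1 b * ‖A' b‖ ≤ ρ') → ∀ i, ‖Dfun A' i‖ ≤ CD * ρ' ^ 2)
    (hcd : ContDiffOn ℂ ω Dfun {Y : PBond P 0 → Matrix (Fin N) (Fin N) ℂ | ∀ b, w 1 b * ‖Y b‖ < ε})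
    -- the fibre letters (g0's `K0Stub1FibreTraceLetters.exists_fibreLetters`: `τ = ntr`, dualiser `ρ`, `M_ρ = N³`)
    (τ : Matrix (Fin N) (Fin N) ℂ →L[ℂ] ℂ) (ρ : (Matrix (Fin N) (Fin N) ℂ →L[ℂ] ℂ) →L[ℂ] Matrix (Fin N) (Fin N) ℂ)
    (hρ : ∀ (ℓ' : Matrix (Fin N) (Fin N) ℂ →L[ℂ] ℂ) (X : Matrix (Fin N) (Fin N) ℂ), τ (ρ ℓ' * X) = ℓ' X)
    (hτ : ∀ a b : Matrix (Fin N) (Fin N) ℂ, τ (a * b) = τ (b * a)) (hτs : ∀ a : Matrix (Fin N) (Fin N) ℂ, τ (star a) = starRingEnd ℂ (τ a))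
    (hτ1 : ∀ X : Matrix (Fin N) (Fin N) ℂ, ‖τ X‖ ≤ ‖X‖) {Mρ : ℝ} (hMρ : 0 ≤ Mρ) (hρn : ∀ ℓ' : Matrix (Fin N) (Fin N) ℂ →L[ℂ] ℂ, ‖ρ ℓ'‖ ≤ Mρ * ‖ℓ'‖)
    -- the pairings (27) ∕ (66), a `B`-symmetric multiplier, any average `Q` of the multiplier term
    (BE : (PBond P 0 → Matrix (Fin N) (Fin N) ℂ) →L[ℂ] (PBond P 0 → Matrix (Fin N) (Fin N) ℂ) →L[ℂ] ℂ)
    (hBE : ∀ Y δ : PBond P 0 → Matrix (Fin N) (Fin N) ℂ, BE Y δ =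
      bondPair (((P.L : ℝ))⁻¹ ^ k) P.d (τ : Matrix (Fin N) (Fin N) ℂ →ₗ[ℂ] ℂ) (fun μ x => Y ⟨x, μ⟩) (fun μ x => δ ⟨x, μ⟩))
    (B : (BondIdx Dm → Matrix (Fin N) (Fin N) ℂ) →L[ℂ] (BondIdx Dm → Matrix (Fin N) (Fin N) ℂ) →L[ℂ] ℂ)
    (hB : ∀ X X' : BondIdx Dm → Matrix (Fin N) (Fin N) ℂ, B X X' = ∑ t, τ (X t * X' t)) (hBsymm : ∀ a b, B a b = B b a)
    (MV : (BondIdx Dm → Matrix (Fin N) (Fin N) ℂ) →L[ℂ] (BondIdx Dm → Matrix (Fin N) (Fin N) ℂ)) (hMsym : ∀ a b, B (MV a) b = B a (MV b))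
    (Q : (PBond P 0 → Matrix (Fin N) (Fin N) ℂ) →L[ℂ] (BondIdx Dm → Matrix (Fin N) (Fin N) ℂ)) :
    ∃ (Qt : (BondIdx Dm → Matrix (Fin N) (Fin N) ℂ) →L[ℂ] (PBond P 0 → Matrix (Fin N) (Fin N) ℂ)) (Ht : (PBond P 0 → Matrix (Fin N) (Fin N) ℂ) →L[ℂ] (BondIdx Dm → Matrix (Fin N) (Fin N) ℂ))
      (Dt : (PBond P 0 → Matrix (Fin N) (Fin N) ℂ) → ((BondIdx Dm → Matrix (Fin N) (Fin N) ℂ) →L[ℂ] (PBond P 0 → Matrix (Fin N) (Fin N) ℂ))),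
      -- `Qt`, `Ht`, `Dt` (by formula, part 1)
      (∀ X δ, BE (Qt X) δ = B X (Q δ)) ∧ (∀ Z X, BE Z (H X) = B (Ht Z) X) ∧
      (∀ (A' : PBond P 0 → Matrix (Fin N) (Fin N) ℂ) X δ, BE (Dt A' X) δ = B X (fderiv ℂ Dfun A' δ)) ∧
      -- ★ THE W-SLOT MODULO THE NUMERIC LETTERS
      ∀ (wB' : BondIdx Dm → ℝ) (O₁ q₀ θ₀ h₀ ℓ q : ℝ), 0 ≤ O₁ → 0 ≤ θ₀ → 0 ≤ h₀ → 1 + B₀ * CD * ε ≤ ℓ → 1 + B₁ * CD * ε ≤ ℓ → ℓ * ε ≤ 1 / 16 →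
        -- (3.132) for `M` (input block weight `1`, output block weight `wB′`)
        (∀ (X : BondIdx Dm → Matrix (Fin N) (Fin N) ℂ) (s : ℝ), (∀ i, (1 : ℝ) * ‖X i‖ ≤ s) → ∀ i, wB' i * ‖MV X i‖ ≤ O₁ * s) →
        -- the column letter of `Qt`
        (∀ (X : BondIdx Dm → Matrix (Fin N) (Fin N) ℂ) (s : ℝ), (∀ i, wB' i * ‖X i‖ ≤ s) → ∀ b, w 3 b * ‖Qt X b‖ ≤ q₀ * s) →
        -- (73)ᵀ for `Dt`
        (∀ (A' : PBond P 0 → Matrix (Fin N) (Fin N) ℂ) (r : ℝ), (∀ b, w 1 b * ‖A' b‖ ≤ r) →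
          (∀ (b : PBond P 0) (ν : Fin P.d), w 2 b * (P.L : ℝ) ^ k * ‖A' ⟨b.src.shift ν, b.dir⟩ - A' b‖ ≤ r) → r < ε →
          ∀ (X : BondIdx Dm → Matrix (Fin N) (Fin N) ℂ) (s : ℝ), (∀ i, wB' i * ‖X i‖ ≤ s) → ∀ b, w 3 b * ‖Dt A' X b‖ ≤ θ₀ * r * s) →
        -- (46)ᵀ for `Ht`
        (∀ (Z : PBond P 0 → Matrix (Fin N) (Fin N) ℂ) (s : ℝ), (∀ b, w 3 b * ‖Z b‖ ≤ s) → ∀ i, wB' i * ‖Ht Z i‖ ≤ h₀ * s) →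
        -- the averaging letter of `Q`
        (∀ (A' : PBond P 0 → Matrix (Fin N) (Fin N) ℂ) (r : ℝ), (∀ b, w 1 b * ‖A' b‖ ≤ r) → ∀ i, (1 : ℝ) * ‖Q A' i‖ ≤ q * r) →
        ∃ (e : Site P 0 ≃ TSite P.d (fun _ => P.sitesPerDir 0)) (W : (PBond P 0 → Matrix (Fin N) (Fin N) ℂ) → (PBond P 0 → Matrix (Fin N) (Fin N) ℂ)),
          (∀ (x : Site P 0) (μ : Fin P.d), e (x.shift μ) = B9SectCLatticeCarrier.shift μ (e x)) ∧
          (∀ A' : PBond P 0 → Matrix (Fin N) (Fin N) ℂ, (∀ b, w 1 b * ‖A' b‖ < ε) →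
            (∀ (b : PBond P 0) (ν : Fin P.d), w 2 b * (P.L : ℝ) ^ k * ‖A' ⟨b.src.shift ν, b.dir⟩ - A' b‖ < ε) →
            HasFDerivAt (fun A : PBond P 0 → Matrix (Fin N) (Fin N) ℂ => 2⁻¹ * B (Dfun A) (MV (Dfun A)) - B (Q A) (MV (Dfun A))
                + V0 (LatticeFieldCalculus.shiftEquiv (P := P) (j := 0)) (fun _ _ => (1 : (Matrix (Fin N) (Fin N) ℂ)ˣ)) (((P.L : ℝ)⁻¹) ^ k) P.d
                    (τ : Matrix (Fin N) (Fin N) ℂ →ₗ[ℂ] ℂ) (fun μ x => (A - H (Dfun A)) ⟨x, μ⟩))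
              (BE (W A')) A') ∧
          DifferentiableOn ℂ W {Y : PBond P 0 → Matrix (Fin N) (Fin N) ℂ | (∀ b, w 1 b * ‖Y b‖ < ε) ∧
            ∀ (b : PBond P 0) (ν : Fin P.d), w 2 b * (P.L : ℝ) ^ k * ‖Y ⟨b.src.shift ν, b.dir⟩ - Y b‖ < ε} ∧
          (∀ (Y : PBond P 0 → Matrix (Fin N) (Fin N) ℂ) (r : ℝ), r < ε → (∀ b, w 1 b * ‖Y b‖ ≤ r) →
            (∀ (b : PBond P 0) (ν : Fin P.d), w 2 b * (P.L : ℝ) ^ k * ‖Y ⟨b.src.shift ν, b.dir⟩ - Y b‖ ≤ r) →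
            ∀ b, w 3 b * ‖W Y b‖ ≤
              (θ₀ * O₁ * (CD * ε + q) + q₀ * O₁ * CD
                + (1 + θ₀ * ε * h₀) * (((P.d - 1 : ℕ) : ℝ) * ((P.L : ℝ) ^ 2) ^ 3 * Mρ * (200 + 2 * (P.L : ℝ) ^ 2)) * ℓ ^ 2)
                * r ^ 2) := by
  haveI : CompleteSpace (Matrix (Fin N) (Fin N) ℂ) := FiniteDimensional.complete ℂ _
  have hL0 : (0 : ℝ) < P.L := by exact_mod_cast P.L_pos
  have hwpos : ∀ b, 0 < w 1 b := fun b => by rw [hw 1 b, pow_one]; positivity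
  have hw2 : ∀ b, 0 ≤ w 2 b := fun b => by rw [hw 2 b]; positivity
  -- regularity of the socket's chart from its analyticity (generic: Mathlib, no chart-specific lemma)
  have hO : IsOpen {Y : PBond P 0 → Matrix (Fin N) (Fin N) ℂ | ∀ b, w 1 b * ‖Y b‖ < ε} := isOpen_weightedBall (n := Fin N) w ε
  have hDd : DifferentiableOn ℂ Dfun {Y : PBond P 0 → Matrix (Fin N) (Fin N) ℂ | ∀ b, w 1 b * ‖Y b‖ < ε} := hcd.differentiableOn (by simp)
  have hDat : ∀ A' : PBond P 0 → Matrix (Fin N) (Fin N) ℂ, (∀ b, w 1 b * ‖A' b‖ < ε) → HasFDerivAt Dfun (fderiv ℂ Dfun A') A' :=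
    fun A' hA' => ((hDd A' hA').differentiableAt (hO.mem_nhds hA')).hasFDerivAt
  have h𝔇d : DifferentiableOn ℂ (fderiv ℂ Dfun) {Y : PBond P 0 → Matrix (Fin N) (Fin N) ℂ | ∀ b, w 1 b * ‖Y b‖ < ε} := by
    have h2' : ContDiffOn ℂ (1 + 1) Dfun {Y : PBond P 0 → Matrix (Fin N) (Fin N) ℂ | ∀ b, w 1 b * ‖Y b‖ < ε} := hcd.of_le le_top
    exact ((contDiffOn_succ_iff_fderiv_of_isOpen hO).1 h2').2.2.differentiableOn one_ne_zero
  have hsub : {Y : PBond P 0 → Matrix (Fin N) (Fin N) ℂ | (∀ b, w 1 b * ‖Y b‖ < ε) ∧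
      ∀ (b : PBond P 0) (ν : Fin P.d), w 2 b * (P.L : ℝ) ^ k * ‖Y ⟨b.src.shift ν, b.dir⟩ - Y b‖ < ε} ⊆
      {Y : PBond P 0 → Matrix (Fin N) (Fin N) ℂ | ∀ b, w 1 b * ‖Y b‖ < ε} := fun Y hY => hY.1
  -- part 1: the transposes of `Q`, `H`, `𝔇` by formula
  obtain ⟨Qt, Ht, Dt, hQt, hHt, hDt, hDtreg, -, -, -⟩ :=
    exists_capstoneTransposes (β := BondIdx Dm) k hL0.ne' τ ρ hρ BE hBE B hB Q (LinearMap.toContinuousLinearMap H) (fun A' => fderiv ℂ Dfun A')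
  -- part 5: the one-step collar
  have hcollar := oneStepCollar_of_adm22 Dm hAdm hRM
  refine ⟨Qt, Ht, Dt, hQt, hHt, hDt, ?_⟩
  intro wB' O₁ q₀ θ₀ h₀ ℓ q hO₁ hθ₀ hh₀ hℓ₀ hℓ₁ hℓa h3132 hQt' h73t h46t hQ
  have hℓ0 : 0 ≤ ℓ := le_trans (by positivity) hℓ₀
  -- (55) in the capstone's shape (block weight `1`)
  have h55' : ∀ (A' : PBond P 0 → Matrix (Fin N) (Fin N) ℂ) (r : ℝ), (∀ b, w 1 b * ‖A' b‖ ≤ r) →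
      (∀ (b : PBond P 0) (ν : Fin P.d), w 2 b * (P.L : ℝ) ^ k * ‖A' ⟨b.src.shift ν, b.dir⟩ - A' b‖ ≤ r) → r < ε →
      ∀ i, (1 : ℝ) * ‖Dfun A' i‖ ≤ CD * r ^ 2 := by
    intro A' r h0 _ hr i
    rw [one_mul]
    have hA'ε : ∀ b, w 1 b * ‖A' b‖ < ε := fun b => (h0 b).trans_lt hr
    have hr0 : 0 ≤ r := le_trans (mul_nonneg (hwpos ⟨fun _ => 0, ⟨0, P.hd⟩⟩).le (norm_nonneg _)) (h0 _)
    exact h55 A' hA'ε r hr0 h0 i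
  -- (57) ∧ (58): both halves of the capstone's `h57` from the two (46) rows of `H` and (55)
  have h57 : ∀ (A' : PBond P 0 → Matrix (Fin N) (Fin N) ℂ) (r : ℝ), (∀ b, w 1 b * ‖A' b‖ ≤ r) →
      (∀ (b : PBond P 0) (ν : Fin P.d), w 2 b * (P.L : ℝ) ^ k * ‖A' ⟨b.src.shift ν, b.dir⟩ - A' b‖ ≤ r) → r < ε →
      (∀ b, w 1 b * ‖(A' - H (Dfun A')) b‖ ≤ ℓ * r) ∧
        ∀ (b : PBond P 0) (ν : Fin P.d),
          w 2 b * (P.L : ℝ) ^ k * ‖(A' - H (Dfun A')) ⟨b.src.shift ν, b.dir⟩ - (A' - H (Dfun A')) b‖ ≤ ℓ * r := by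
    intro A' r h0 h1 hr
    have hA'ε : ∀ b, w 1 b * ‖A' b‖ < ε := fun b => (h0 b).trans_lt hr
    have hr0 : 0 ≤ r := le_trans (mul_nonneg (hwpos ⟨fun _ => 0, ⟨0, P.hd⟩⟩).le (norm_nonneg _)) (h0 _)
    have hDr : ∀ i, ‖Dfun A' i‖ ≤ CD * r ^ 2 := h55 A' hA'ε r hr0 h0
    have hrε : CD * r ≤ CD * ε := mul_le_mul_of_nonneg_left hr.le hCD
    refine ⟨fun b => ?_, fun b ν => ?_⟩
    · have hHs := hHB (Dfun A') (CD * r ^ 2) (by positivity) hDr b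
      calc w 1 b * ‖(A' - H (Dfun A')) b‖ = w 1 b * ‖A' b - H (Dfun A') b‖ := by rw [Pi.sub_apply]
        _ ≤ w 1 b * (‖A' b‖ + ‖H (Dfun A') b‖) := mul_le_mul_of_nonneg_left (norm_sub_le _ _) (hwpos b).le
        _ = w 1 b * ‖A' b‖ + w 1 b * ‖H (Dfun A') b‖ := by ring
        _ ≤ r + B₀ * (CD * r ^ 2) := add_le_add (h0 b) hHs
        _ = (1 + B₀ * CD * r) * r := by ring
        _ ≤ (1 + B₀ * CD * ε) * r := by
            apply mul_le_mul_of_nonneg_right _ hr0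
            have : B₀ * CD * r ≤ B₀ * CD * ε := by
              have := mul_le_mul_of_nonneg_left hrε hB₀
              linarith [this]
            linarith
        _ ≤ ℓ * r := mul_le_mul_of_nonneg_right hℓ₀ hr0
    · have hHg := hHgrad (Dfun A') (CD * r ^ 2) (by positivity) hDr b ν
      have hsplit : (A' - H (Dfun A')) ⟨b.src.shift ν, b.dir⟩ - (A' - H (Dfun A')) b
          = (A' ⟨b.src.shift ν, b.dir⟩ - A' b) - (H (Dfun A') ⟨b.src.shift ν, b.dir⟩ - H (Dfun A') b) := by
        simp only [Pi.sub_apply]; abel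
      rw [hsplit]
      calc w 2 b * (P.L : ℝ) ^ k * ‖(A' ⟨b.src.shift ν, b.dir⟩ - A' b) - (H (Dfun A') ⟨b.src.shift ν, b.dir⟩ - H (Dfun A') b)‖
          ≤ w 2 b * (P.L : ℝ) ^ k * (‖A' ⟨b.src.shift ν, b.dir⟩ - A' b‖ + ‖H (Dfun A') ⟨b.src.shift ν, b.dir⟩ - H (Dfun A') b‖) :=
            mul_le_mul_of_nonneg_left (norm_sub_le _ _) (mul_nonneg (hw2 b) (by positivity))
        _ = w 2 b * (P.L : ℝ) ^ k * ‖A' ⟨b.src.shift ν, b.dir⟩ - A' b‖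
              + w 2 b * (P.L : ℝ) ^ k * ‖H (Dfun A') ⟨b.src.shift ν, b.dir⟩ - H (Dfun A') b‖ := by ring
        _ ≤ r + B₁ * (CD * r ^ 2) := add_le_add (h1 b ν) hHg
        _ = (1 + B₁ * CD * r) * r := by ring
        _ ≤ (1 + B₁ * CD * ε) * r := by
            apply mul_le_mul_of_nonneg_right _ hr0
            have : B₁ * CD * r ≤ B₁ * CD * ε := by
              have := mul_le_mul_of_nonneg_left hrε hB₁
              linarith [this]
            linarith
        _ ≤ ℓ * r := mul_le_mul_of_nonneg_right hℓ₁ hr0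
  -- the capstone of `K0Stub1SectFWSlotOneLevel`
  obtain ⟨e, W₀, W, he, -, -, hcert, hWd, hWq⟩ :=
    exists_sectF_W_levOf P hd k (fun j => {x : Site P 0 | Dm.InOm j x}) hcollar w hw ρ τ hρ hτ hτs hτ1 BE hBE B hBsymm
      Q MV hMsym (LinearMap.toContinuousLinearMap H) Qt hQt Ht hHt (a₃ := ε) Dfun (fun A' => fderiv ℂ Dfun A') Dt
      (fun A' hA' _ => hDat A' hA')
      (fun A' _ _ X δ => hDt A' X δ) (hDd.mono hsub) ((hDtreg _ h𝔇d).mono hsub)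
      (fun _ => (1 : ℝ)) wB' (fun _ => zero_le_one)
      (O₁ := O₁) (q₀ := q₀) (θ₀ := θ₀) (h₀ := h₀) (CD := CD) (q := q) (ℓ := ℓ)
      hO₁ hθ₀ hh₀ hCD hℓ0 hℓa h3132 hQt' h73t h46t h55' hQ h57
  refine ⟨e, W, he, hcert, hWd, fun Y r hr h0 h1 b => (hWq Y r hr h0 h1 b).trans ?_⟩
  have hΘ : 0 ≤ 1 + θ₀ * ε * h₀ := by have := mul_nonneg (mul_nonneg hθ₀ hε.le) hh₀; linarith
  exact fibreSlotConst_le_of_letterBounds ρ τ hMρ hρn hτ1 (Nat.cast_nonneg _) (by positivity) (by positivity) hΘ (sq_nonneg _) (sq_nonneg _)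


/-! ## §2  The record's four-tori: the socket with `O₁` DISCHARGED for the multiplier of record `η^d•M_V` (k0-s1-w4's p616957) -/

/-- ★★★ **CHART-SOCKET EDITION AT EVERY ADMISSIBLE FAMILY OF THE RECORD's FOUR-TORI, MULTIPLIER `η^d•M_V`, `O₁` DISCHARGED** — for every `F : T4Family`, `N ≥ 1`:
`∃ Mh₀ R₀ O₁ ≥ 0` such that at every admissible nested family in the standing range (`1 ≤ K − n`, `K − n + 1 ≤ m + K`, `M_h = L^{a′} ≥ Mh₀`, `R ≥ R₀`, `a′ + 3 ≤ m + n`,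
`Adm22 D R (L·M_h)`), for the level weights, ANY ℂ-linear `H` with the two (46) rows, ANY chart socket (`ε > 0`, `C_D ≥ 0`, `Dfun` with the (55) family, `ContDiffOn ℂ ω`),
the fibre letters, the pairings, EVERY `M_V` with p598821's kernel formula (`c = L^{K−n}`, any auxiliary weights) and ANY `Q`: §1's conclusion at `MV := η^d•M_V` with the
`h3132`∕`0 ≤ O₁` binders GONE (k0-s1-w4 `h3132_of_adm22_T4` on the band `0 ≤ wB′(t) ≤ (L^{j(t)}η)⁻¹`).
[cite: Balaban1985Variational, Prop. 4 (97)-(98) pp.292-293, (157)-(158) p.302, (87)-(90) p.291; Balaban1984PropagatorsII, Prop. 2.7 (2.149) p.249, Lemma 2.1 (2.61) p.234, Cor. 2.8 p.249] -/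
theorem exists_sectF_W_atRecord_of_chartSocket_O1 (N : ℕ) [NeZero N] (F : T4Family) :
    ∃ (Mh₀ R₀ : ℕ) (O₁ : ℝ), 0 ≤ O₁ ∧
    ∀ (n K : ℕ) (_ : 1 ≤ K - n) (_ : K - n + 1 ≤ F.m + K) {Mh R a' : ℕ} (_ : Mh = F.L ^ a') (_ : Mh₀ ≤ Mh) (_ : R₀ ≤ R)
      (_ : a' + 3 ≤ F.m + n) (D : Domains (F.P K)) (hDk : D.k = K - n) (_ : Adm22 D R (F.L * Mh))
      [Fact ((0 : ℝ) < ((F.P K).L : ℝ))] [Fact ((0 : ℝ) < (((F.P K).L : ℝ))⁻¹ ^ (K - n))]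
    {w : ℕ → PBond (F.P K) 0 → ℝ} (hw : IsLevWeight (F.P K) (K - n) D w)
    (H : (BondIdx D → Matrix (Fin N) (Fin N) ℂ) →ₗ[ℂ] (PBond (F.P K) 0 → Matrix (Fin N) (Fin N) ℂ))
    {B₀ : ℝ} (hB₀ : 0 ≤ B₀)
    (hHB : ∀ (X : BondIdx D → Matrix (Fin N) (Fin N) ℂ) (t : ℝ), 0 ≤ t → (∀ i, ‖X i‖ ≤ t) → ∀ b, w 1 b * ‖H X b‖ ≤ B₀ * t)
    {B₁ : ℝ} (hB₁ : 0 ≤ B₁)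
    (hHgrad : ∀ (X : BondIdx D → Matrix (Fin N) (Fin N) ℂ) (t : ℝ), 0 ≤ t → (∀ i, ‖X i‖ ≤ t) →
      ∀ (b : PBond (F.P K) 0) (ν : Fin (F.P K).d), w 2 b * ((F.P K).L : ℝ) ^ (K - n) * ‖H X ⟨b.src.shift ν, b.dir⟩ - H X b‖ ≤ B₁ * t)
    {ε : ℝ} (hε : 0 < ε) {CD : ℝ} (hCD : 0 ≤ CD)
    (Dfun : (PBond (F.P K) 0 → Matrix (Fin N) (Fin N) ℂ) → (BondIdx D → Matrix (Fin N) (Fin N) ℂ))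
    (h55 : ∀ A' : PBond (F.P K) 0 → Matrix (Fin N) (Fin N) ℂ, (∀ b, w 1 b * ‖A' b‖ < ε) →
      ∀ ρ' : ℝ, 0 ≤ ρ' → (∀ b, w 1 b * ‖A' b‖ ≤ ρ') → ∀ i, ‖Dfun A' i‖ ≤ CD * ρ' ^ 2)
    (hcd : ContDiffOn ℂ ω Dfun {Y : PBond (F.P K) 0 → Matrix (Fin N) (Fin N) ℂ | ∀ b, w 1 b * ‖Y b‖ < ε})
    (τ : Matrix (Fin N) (Fin N) ℂ →L[ℂ] ℂ) (ρ : (Matrix (Fin N) (Fin N) ℂ →L[ℂ] ℂ) →L[ℂ] Matrix (Fin N) (Fin N) ℂ)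
    (hρ : ∀ (ℓ' : Matrix (Fin N) (Fin N) ℂ →L[ℂ] ℂ) (X : Matrix (Fin N) (Fin N) ℂ), τ (ρ ℓ' * X) = ℓ' X)
    (hτ : ∀ a b : Matrix (Fin N) (Fin N) ℂ, τ (a * b) = τ (b * a)) (hτs : ∀ a : Matrix (Fin N) (Fin N) ℂ, τ (star a) = starRingEnd ℂ (τ a))
    (hτ1 : ∀ X : Matrix (Fin N) (Fin N) ℂ, ‖τ X‖ ≤ ‖X‖) {Mρ : ℝ} (hMρ : 0 ≤ Mρ) (hρn : ∀ ℓ' : Matrix (Fin N) (Fin N) ℂ →L[ℂ] ℂ, ‖ρ ℓ'‖ ≤ Mρ * ‖ℓ'‖)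
    (BE : (PBond (F.P K) 0 → Matrix (Fin N) (Fin N) ℂ) →L[ℂ] (PBond (F.P K) 0 → Matrix (Fin N) (Fin N) ℂ) →L[ℂ] ℂ)
    (hBE : ∀ Y δ : PBond (F.P K) 0 → Matrix (Fin N) (Fin N) ℂ, BE Y δ =
      bondPair ((((F.P K).L : ℝ))⁻¹ ^ (K - n)) (F.P K).d (τ : Matrix (Fin N) (Fin N) ℂ →ₗ[ℂ] ℂ) (fun μ x => Y ⟨x, μ⟩) (fun μ x => δ ⟨x, μ⟩))
    (B : (BondIdx D → Matrix (Fin N) (Fin N) ℂ) →L[ℂ] (BondIdx D → Matrix (Fin N) (Fin N) ℂ) →L[ℂ] ℂ)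
    (hB : ∀ X X' : BondIdx D → Matrix (Fin N) (Fin N) ℂ, B X X' = ∑ t, τ (X t * X' t)) (hBsymm : ∀ a b, B a b = B b a)
    (hc : ((F.P K).L : ℝ) ^ (K - n) ≠ 0) {wa : BondIdx D → ℝ} (hwa : ∀ i, 0 < wa i)
    (MV : (BondIdx D → Matrix (Fin N) (Fin N) ℂ) →L[ℂ] (BondIdx D → Matrix (Fin N) (Fin N) ℂ))
    (hMV : ∀ (X : BondIdx D → Matrix (Fin N) (Fin N) ℂ) (t : BondIdx D),
      MV X t = ∑ s, ((WithLp.ofLp ((EE D hc hwa - aE D wa) (WithLp.toLp 2 (Pi.single s 1))) t : ℝ) : ℂ) • X s)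
    (hMsym : ∀ a b, B (MV a) b = B a (MV b))
    (Q : (PBond (F.P K) 0 → Matrix (Fin N) (Fin N) ℂ) →L[ℂ] (BondIdx D → Matrix (Fin N) (Fin N) ℂ)),
    ∃ (Qt : (BondIdx D → Matrix (Fin N) (Fin N) ℂ) →L[ℂ] (PBond (F.P K) 0 → Matrix (Fin N) (Fin N) ℂ)) (Ht : (PBond (F.P K) 0 → Matrix (Fin N) (Fin N) ℂ) →L[ℂ] (BondIdx D → Matrix (Fin N) (Fin N) ℂ))
      (Dt : (PBond (F.P K) 0 → Matrix (Fin N) (Fin N) ℂ) → ((BondIdx D → Matrix (Fin N) (Fin N) ℂ) →L[ℂ] (PBond (F.P K) 0 → Matrix (Fin N) (Fin N) ℂ))),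
      (∀ X δ, BE (Qt X) δ = B X (Q δ)) ∧ (∀ Z X, BE Z (H X) = B (Ht Z) X) ∧
      (∀ (A' : PBond (F.P K) 0 → Matrix (Fin N) (Fin N) ℂ) X δ, BE (Dt A' X) δ = B X (fderiv ℂ Dfun A' δ)) ∧
      ∀ (wB' : BondIdx D → ℝ) (q₀ θ₀ h₀ ℓ q : ℝ), (∀ t, 0 ≤ wB' t) →
        (∀ t : BondIdx D, wB' t * (((F.P K).L : ℝ) ^ (t.1.1 : ℕ) * ((((F.P K).L : ℝ))⁻¹) ^ (K - n)) ≤ 1) →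
        0 ≤ θ₀ → 0 ≤ h₀ → 1 + B₀ * CD * ε ≤ ℓ → 1 + B₁ * CD * ε ≤ ℓ → ℓ * ε ≤ 1 / 16 →
        (∀ (X : BondIdx D → Matrix (Fin N) (Fin N) ℂ) (s : ℝ), (∀ i, wB' i * ‖X i‖ ≤ s) → ∀ b, w 3 b * ‖Qt X b‖ ≤ q₀ * s) →
        (∀ (A' : PBond (F.P K) 0 → Matrix (Fin N) (Fin N) ℂ) (r : ℝ), (∀ b, w 1 b * ‖A' b‖ ≤ r) →
          (∀ (b : PBond (F.P K) 0) (ν : Fin (F.P K).d), w 2 b * ((F.P K).L : ℝ) ^ (K - n) * ‖A' ⟨b.src.shift ν, b.dir⟩ - A' b‖ ≤ r) → r < ε →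
          ∀ (X : BondIdx D → Matrix (Fin N) (Fin N) ℂ) (s : ℝ), (∀ i, wB' i * ‖X i‖ ≤ s) → ∀ b, w 3 b * ‖Dt A' X b‖ ≤ θ₀ * r * s) →
        (∀ (Z : PBond (F.P K) 0 → Matrix (Fin N) (Fin N) ℂ) (s : ℝ), (∀ b, w 3 b * ‖Z b‖ ≤ s) → ∀ i, wB' i * ‖Ht Z i‖ ≤ h₀ * s) →
        (∀ (A' : PBond (F.P K) 0 → Matrix (Fin N) (Fin N) ℂ) (r : ℝ), (∀ b, w 1 b * ‖A' b‖ ≤ r) → ∀ i, (1 : ℝ) * ‖Q A' i‖ ≤ q * r) →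
        ∃ (e : Site (F.P K) 0 ≃ TSite (F.P K).d (fun _ => (F.P K).sitesPerDir 0)) (W : (PBond (F.P K) 0 → Matrix (Fin N) (Fin N) ℂ) → (PBond (F.P K) 0 → Matrix (Fin N) (Fin N) ℂ)),
          (∀ (x : Site (F.P K) 0) (μ : Fin (F.P K).d), e (x.shift μ) = B9SectCLatticeCarrier.shift μ (e x)) ∧
          (∀ A' : PBond (F.P K) 0 → Matrix (Fin N) (Fin N) ℂ, (∀ b, w 1 b * ‖A' b‖ < ε) →
            (∀ (b : PBond (F.P K) 0) (ν : Fin (F.P K).d), w 2 b * ((F.P K).L : ℝ) ^ (K - n) * ‖A' ⟨b.src.shift ν, b.dir⟩ - A' b‖ < ε) →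
            HasFDerivAt (fun A : PBond (F.P K) 0 → Matrix (Fin N) (Fin N) ℂ => 2⁻¹ * B (Dfun A) (((((((((F.P K).L : ℝ))⁻¹) ^ (K - n) : ℝ) : ℂ) ^ (F.P K).d) • MV) (Dfun A)) - B (Q A) (((((((((F.P K).L : ℝ))⁻¹) ^ (K - n) : ℝ) : ℂ) ^ (F.P K).d) • MV) (Dfun A))
                + V0 (LatticeFieldCalculus.shiftEquiv (P := F.P K) (j := 0)) (fun _ _ => (1 : (Matrix (Fin N) (Fin N) ℂ)ˣ)) ((((F.P K).L : ℝ)⁻¹) ^ (K - n)) (F.P K).d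
                    (τ : Matrix (Fin N) (Fin N) ℂ →ₗ[ℂ] ℂ) (fun μ x => (A - H (Dfun A)) ⟨x, μ⟩))
              (BE (W A')) A') ∧
          DifferentiableOn ℂ W {Y : PBond (F.P K) 0 → Matrix (Fin N) (Fin N) ℂ | (∀ b, w 1 b * ‖Y b‖ < ε) ∧
            ∀ (b : PBond (F.P K) 0) (ν : Fin (F.P K).d), w 2 b * ((F.P K).L : ℝ) ^ (K - n) * ‖Y ⟨b.src.shift ν, b.dir⟩ - Y b‖ < ε} ∧
          (∀ (Y : PBond (F.P K) 0 → Matrix (Fin N) (Fin N) ℂ) (r : ℝ), r < ε → (∀ b, w 1 b * ‖Y b‖ ≤ r) →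
            (∀ (b : PBond (F.P K) 0) (ν : Fin (F.P K).d), w 2 b * ((F.P K).L : ℝ) ^ (K - n) * ‖Y ⟨b.src.shift ν, b.dir⟩ - Y b‖ ≤ r) →
            ∀ b, w 3 b * ‖W Y b‖ ≤
              (θ₀ * O₁ * (CD * ε + q) + q₀ * O₁ * CD
                + (1 + θ₀ * ε * h₀) * ((((F.P K).d - 1 : ℕ) : ℝ) * (((F.P K).L : ℝ) ^ 2) ^ 3 * Mρ * (200 + 2 * ((F.P K).L : ℝ) ^ 2)) * ℓ ^ 2)
                * r ^ 2) := by
  obtain ⟨Mh₀, R₀, O₁, hO₁, h31⟩ := h3132_of_adm22_T4 F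
  refine ⟨Mh₀, max R₀ 1, O₁, hO₁, ?_⟩
  intro n K hk1 hk' Mh R a' hMha hMh hR hsize D hDk hAdm _ _ w hw H B₀ hB₀ hHB B₁ hB₁ hHgrad ε hε CD hCD Dfun h55 hcd τ ρ hρ hτ hτs hτ1 Mρ hMρ hρn
    BE hBE B hB hBsymm hc wa hwa MV hMV hMsym Q
  have hMh1 : 1 ≤ Mh := by rw [hMha]; exact Nat.one_le_pow _ _ (F.P K).L_pos
  have hR1 : 1 ≤ R := le_trans (le_max_right _ _) hR
  have hRM : 1 ≤ R * (F.L * Mh) := le_trans hR1 (Nat.le_mul_of_pos_right R (Nat.mul_pos (F.P K).L_pos (by omega)))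
  have hd : 4 ≤ (F.P K).d := le_of_eq (T4Family.P_d F K).symm
  have hMsym' : ∀ a b, B (((((((((F.P K).L : ℝ))⁻¹) ^ (K - n) : ℝ) : ℂ) ^ (F.P K).d) • MV) a) b = B a (((((((((F.P K).L : ℝ))⁻¹) ^ (K - n) : ℝ) : ℂ) ^ (F.P K).d) • MV) b) :=
    fun a b => smul_multiplier_symm B MV hMsym _ a b
  obtain ⟨Qt, Ht, Dt, hQt, hHt, hDt, main⟩ :=
    exists_sectF_W_atRecord_of_chartSocket N (F.P K) hd (K - n) hRM D hAdm hw H hB₀ hHB hB₁ hHgrad hε hCD Dfun h55 hcd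
      τ ρ hρ hτ hτs hτ1 hMρ hρn BE hBE B hB hBsymm _ hMsym' Q
  refine ⟨Qt, Ht, Dt, hQt, hHt, hDt, ?_⟩
  intro wB' q₀ θ₀ h₀ ℓ q hwB0 hwB hθ₀ hh₀ hℓ₀ hℓ₁ hℓa hQt' h73t h46t hQ
  have hR₀ : R₀ ≤ R := le_trans (le_max_left _ _) hR
  have h3132 : ∀ (X : BondIdx D → Matrix (Fin N) (Fin N) ℂ) (s : ℝ), (∀ i, (1 : ℝ) * ‖X i‖ ≤ s) →
      ∀ t, wB' t * ‖((((((((F.P K).L : ℝ))⁻¹) ^ (K - n) : ℝ) : ℂ) ^ (F.P K).d) • MV) X t‖ ≤ O₁ * s :=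
    fun X s hX t => h31 n K hk1 hk' hMha hMh hR₀ hsize D hDk hAdm hc hwa MV hMV wB' hwB0 hwB X s hX t
  exact main wB' O₁ q₀ θ₀ h₀ ℓ q hO₁ hθ₀ hh₀ hℓ₀ hℓ₁ hℓa h3132 hQt' h73t h46t hQ


end Summit.QuantumFields.YangMills.Theorems.K0Stub1SectFWSlotAtRecordSocket

end
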